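import Summits.KontsevichZagierPeriods.KontsevichZagierPeriods.Theorems.HurwitzMicroSectorsHurwitzSectorComplementStubSymReduction
import Summits.KontsevichZagierPeriods.KontsevichZagierPeriods.Theorems.HurwitzMicroSectorsHurwitzSectorComplementStubRigidityNumbers
import Summits.KontsevichZagierPeriods.KontsevichZagierPeriods.Theorems.HurwitzMicroSectorsHurwitzSectorComplementStubConstAcrossDim
import Summits.KontsevichZagierPeriods.KontsevichZagierPeriods.Theorems.HurwitzMicroSectorsHurwitzSectorComplementStubPairValueAlgebraic
import Literature.NumberTheory.Transcendental.KZRelationsLE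
import Literature.NumberTheory.Transcendental.SemialgebraicLineDeriv

/-!
# `HurwitzSectorComplement` (stmt-KontsevichZagierPeriods-14341), line `chebyshev-level-deformation`,
# stub S5 `stub_assembly` — part 1/4: normal forms and the reduction calculus

The assembly stub composes the Chebyshev-ladder descents (S3) and the real-cyclotomic partial
fractions (S4) into Conjecture 1 of Kontsevich–Zagier on the REAL-ALGEBRAIC span of the symmetric
Hurwitz box tower. This kit provides, def-free:

* representations on the open box `KZ.unitCube w = (0,1)^w` (`exists_boxRep`, `exists_addRep`);
* the normal-form weight `∏ 2/(1+xᵢ²)` (`exists_omegaRep`), its box integral `(π/2)^w`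
  (`setIntegral_box_omega`, Fubini) and the value `C + A(π/2)^w` of a normal form
  `[(0,1)^w, C + A·∏ 2/(1+xᵢ²)]` (`value_nf`);
* RIGIDITY of these values for real algebraic `C, A` (`nf_coeffs_eq`: Lindemann,
  `RigidityNumbers.coeffs_eq_zero`);
* the REDUCTION CALCULUS: a function on the box is *reduced* when some representation of it is
  KZ-equivalent to a normal form with algebraic `C, A` (stated inline as an `∃`); reduced functions
  are closed under congruence, addition (rule 1b), real-algebraic scaling (`KZ.IntegralRep.constMul`,
  `KZ.Equivalent.constMul`) and finite sums, contain the algebraic constants, and contain every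
  integrand lying in `ℚ·𝔭_w` in the sense of the descents (`red_of_ratMultiple`).

References: M. Kontsevich, D. Zagier, *Periods* (2001), §1.1–1.2.
-/

noncomputable section

open Set MeasureTheory
open scoped BigOperators
open Literature.NumberTheory.Transcendental

namespace Summit.KontsevichZagierPeriods.Theorems.HurwitzMicroSectorsHurwitzSectorComplement.Assembly

variable {w : ℕ}

/-! ## Representations on the open box `KZ.unitCube w` -/

/-- On the closed unit box the product of the coordinates lies in `[0,1]`. [folklore] -/
theorem prod_mem_Icc {x : Fin w → ℝ} (hx : x ∈ Icc (0 : Fin w → ℝ) 1) :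
    ∏ i, x i ∈ Icc (0 : ℝ) 1 :=
  ⟨Finset.prod_nonneg fun i _ => hx.1 i, Finset.prod_le_one (fun i _ => hx.1 i) fun i _ => hx.2 i⟩

/-- A function continuous on the closed unit box is integrable on the open unit box (compactness).
[folklore] -/
theorem integrableOn_box_of_continuousOn {f : (Fin w → ℝ) → ℝ}
    (hf : ContinuousOn f (Icc (0 : Fin w → ℝ) 1)) : IntegrableOn f (KZ.unitCube w) :=
  (hf.integrableOn_compact isCompact_Icc).mono_set (KZ.unitCube_subset_Icc w)

/-- `x ↦ g(x₀⋯x_{w−1})` is integrable on the open unit box when `g` is continuous on `[0,1]`.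
[folklore] -/
theorem integrableOn_box_comp_prod {g : ℝ → ℝ} (hg : ContinuousOn g (Icc (0 : ℝ) 1)) :
    IntegrableOn (fun x : Fin w → ℝ => g (∏ i, x i)) (KZ.unitCube w) :=
  integrableOn_box_of_continuousOn
    (hg.comp (continuous_finsetProd _ fun i _ => continuous_apply i).continuousOn
      fun _ hx => prod_mem_Icc hx)

/-- `x ↦ x₀⋯x_{w−1}` is `ℚ`-semialgebraic on the open unit box. [folklore] -/
theorem isSemialgebraicFunOn_prod (w : ℕ) :
    IsSemialgebraicFunOn ℚ (KZ.unitCube w) (fun x => ∏ i, x i) :=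
  IsSemialgebraicFunOn.fun_finsetProd _ (KZ.isSemialgebraic_unitCube w)
    fun i _ => isSemialgebraicFunOn_apply (KZ.isSemialgebraic_unitCube w) i

/-- A `ℚ`-semialgebraic integrable function on the open unit box defines an integral
representation with that domain and that integrand. [cite: KontsevichZagier2001, §1.1] -/
theorem exists_boxRep {f : (Fin w → ℝ) → ℝ} (hf : IsSemialgebraicFunOn ℚ (KZ.unitCube w) f)
    (hi : IntegrableOn f (KZ.unitCube w)) :
    ∃ s : KZ.IntegralRep w, s.domain = KZ.unitCube w ∧ s.integrand = f :=
  ⟨⟨KZ.unitCube w, f, KZ.isSemialgebraic_unitCube w, hf, hi⟩, rfl, rfl⟩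

/-- The sum of two representations on a common domain, and the integrand-additivity move
`[s] − [s₁] − [s₂] ∈ relations`. [cite: KontsevichZagier2001, §1.2 rule (1)] -/
theorem exists_addRep {n : ℕ} (s₁ s₂ : KZ.IntegralRep n) (hd : s₂.domain = s₁.domain) :
    ∃ s : KZ.IntegralRep n, s.domain = s₁.domain ∧
      (s.integrand = fun x => s₁.integrand x + s₂.integrand x) ∧
      KZ.of s - KZ.of s₁ - KZ.of s₂ ∈ KZ.relations := by
  let s : KZ.IntegralRep n :=
    ⟨s₁.domain, fun x => s₁.integrand x + s₂.integrand x, s₁.isSemialgebraic_domain,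
      s₁.isSemialgebraicFunOn_integrand.fun_add (hd ▸ s₂.isSemialgebraicFunOn_integrand),
      s₁.integrableOn.add (hd ▸ s₂.integrableOn)⟩
  exact ⟨s, rfl, rfl,
    KZ.integrandAddRel_subset_relations ⟨n, s, s₁, s₂, rfl, hd, fun x _ => rfl, rfl⟩⟩

/-! ## The normal-form weight `∏ 2/(1+xᵢ²)` -/

/-- The weight `∏ᵢ 2/(1+xᵢ²)` is continuous. [folklore] -/
theorem continuous_omega (w : ℕ) :
    Continuous (fun x : Fin w → ℝ => ∏ i, 2 / (1 + (x i) ^ 2)) :=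
  continuous_finsetProd _ fun i _ =>
    continuous_const.div (continuous_const.add ((continuous_apply i).pow 2)) fun x => by
      positivity

/-- The weight `∏ᵢ 2/(1+xᵢ²)` is `ℚ`-semialgebraic on the open unit box. [folklore] -/
theorem isSemialgebraicFunOn_omega (w : ℕ) :
    IsSemialgebraicFunOn ℚ (KZ.unitCube w) (fun x => ∏ i, 2 / (1 + (x i) ^ 2)) :=
  IsSemialgebraicFunOn.fun_finsetProd _ (KZ.isSemialgebraic_unitCube w) fun i _ =>
    (isSemialgebraicFunOn_const_ofNat (KZ.isSemialgebraic_unitCube w) 2).div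
      ((isSemialgebraicFunOn_const_of_isAlgebraic (KZ.isSemialgebraic_unitCube w)
        isAlgebraic_one).fun_add
        ((isSemialgebraicFunOn_apply (KZ.isSemialgebraic_unitCube w) i).fun_pow 2))
      fun x _ => by positivity

/-- The normal-form representation `𝔭_w = [(0,1)^w, ∏ 2/(1+xᵢ²)]` exists. [cite: KontsevichZagier2001, §1.1] -/
theorem exists_omegaRep (w : ℕ) : ∃ P : KZ.IntegralRep w, P.domain = KZ.unitCube w ∧
    P.integrand = fun x => ∏ i, 2 / (1 + (x i) ^ 2) :=
  exists_boxRep (isSemialgebraicFunOn_omega w)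
    (integrableOn_box_of_continuousOn (continuous_omega w).continuousOn)

/-- `∫₀¹ 2 dt/(1+t²) = π/2`. [folklore] -/
theorem integral_Ioo_two_div_one_add_sq :
    ∫ t in Ioo (0:ℝ) 1, 2 / (1 + t ^ 2) = Real.pi / 2 := by
  rw [← integral_Ioc_eq_integral_Ioo, ← intervalIntegral.integral_of_le zero_le_one]
  have : (fun x : ℝ => 2 / (1 + x ^ 2)) = fun x => 2 * (1 + x ^ 2)⁻¹ := by
    funext x; rw [div_eq_mul_inv]
  rw [this, intervalIntegral.integral_const_mul]
  simp only [integral_inv_one_add_sq, Real.arctan_one, Real.arctan_zero, sub_zero]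
  ring

/-- **`∫_{(0,1)^w} ∏ 2/(1+xᵢ²) dx = (π/2)^w`** (Fubini). [folklore] -/
theorem setIntegral_box_omega (w : ℕ) :
    ∫ x in KZ.unitCube w, ∏ i, 2 / (1 + (x i) ^ 2) = (Real.pi / 2) ^ w := by
  unfold KZ.unitCube
  rw [Beukers.volume_restrict_cube]
  have h := integral_fintype_prod_eq_pow (ι := Fin w) (fun t : ℝ => 2 / (1 + t ^ 2))
    (μ := (volume : Measure ℝ).restrict (Ioo (0 : ℝ) 1))
  simp only [Fintype.card_fin, integral_Ioo_two_div_one_add_sq] at h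
  exact h

/-- The value of a normal form `[(0,1)^w, C + A·∏ 2/(1+xᵢ²)]` is `C + A (π/2)^w`. [folklore] -/
theorem value_nf {C A : ℝ} (n : KZ.IntegralRep w) (hnd : n.domain = KZ.unitCube w)
    (hni : ∀ x ∈ KZ.unitCube w, n.integrand x = C + A * ∏ i, 2 / (1 + (x i) ^ 2)) :
    n.value = C + A * (Real.pi / 2) ^ w := by
  have hω := setIntegral_box_omega w
  rw [KZ.IntegralRep.value, hnd]
  unfold KZ.unitCube at hω ⊢
  rw [setIntegral_congr_fun (Beukers.measurableSet_cube w) (fun x hx => hni x hx),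
    integral_add (BoxIntegral.integrableOn_box_const w C)
      ((integrableOn_box_of_continuousOn (continuous_omega w).continuousOn).const_mul A),
    integral_const_mul, BoxIntegral.setIntegral_box_const, hω]

/-! ## Rigidity of the normal-form values (Lindemann) -/

/-- `C + A (π/2)^w = C' + A' (π/2)^{w'}` with real algebraic `C, A, C', A'` and `w, w' ≠ 0` forces
`C = C'`, and `A = A'` if `w = w'`, resp. `A = A' = 0` if `w ≠ w'` (`RigidityNumbers.coeffs_eq_zero`,
transcendence of `π`). [folklore] -/
theorem nf_coeffs_eq {C A C' A' : ℝ} (hC : IsAlgebraic ℚ C) (hA : IsAlgebraic ℚ A)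
    (hC' : IsAlgebraic ℚ C') (hA' : IsAlgebraic ℚ A') {w w' : ℕ} (hw : w ≠ 0) (hw' : w' ≠ 0)
    (h : C + A * (Real.pi / 2) ^ w = C' + A' * (Real.pi / 2) ^ w') :
    C = C' ∧ (w = w' → A = A') ∧ (w ≠ w' → A = 0 ∧ A' = 0) := by
  have h2 : IsAlgebraic ℚ (2 : ℝ) := by simpa using isAlgebraic_nat (R := ℚ) (A := ℝ) 2
  have h2w : (2 : ℝ) ^ w ≠ 0 := pow_ne_zero _ two_ne_zero
  have h2w' : (2 : ℝ) ^ w' ≠ 0 := pow_ne_zero _ two_ne_zero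
  rw [div_pow, div_pow] at h
  by_cases hww : w = w'
  · subst hww
    obtain ⟨e₀, e₁, -⟩ := RigidityNumbers.coeffs_eq_zero (β₀ := C - C')
      (β₁ := (A - A') * (2 ^ w)⁻¹) (β₂ := 0) (w := w) (w' := w + 1) (hC.sub hC')
      ((hA.sub hA').mul (h2.pow w).inv) isAlgebraic_zero hw (by omega) (by omega)
      (by linear_combination h)
    refine ⟨sub_eq_zero.mp e₀, fun _ => ?_, fun hne => absurd rfl hne⟩
    rcases mul_eq_zero.mp e₁ with e | e
    · exact sub_eq_zero.mp e
    · exact absurd e (inv_ne_zero h2w)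
  · obtain ⟨e₀, e₁, e₂⟩ := RigidityNumbers.coeffs_eq_zero (β₀ := C - C') (β₁ := A * (2 ^ w)⁻¹)
      (β₂ := -(A' * (2 ^ w')⁻¹)) (w := w) (w' := w') (hC.sub hC') (hA.mul (h2.pow w).inv)
      (hA'.mul (h2.pow w').inv).neg hw hw' hww (by linear_combination h)
    refine ⟨sub_eq_zero.mp e₀, fun he => absurd he hww, fun _ => ⟨?_, ?_⟩⟩
    · rcases mul_eq_zero.mp e₁ with e | e
      · exact e
      · exact absurd e (inv_ne_zero h2w)
    · rcases mul_eq_zero.mp (neg_eq_zero.mp e₂) with e | e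
      · exact e
      · exact absurd e (inv_ne_zero h2w')

/-! ## Reducibility to the normal form

A function `f` on the open box is *reduced* (to the normal form) when some representation
`s = [(0,1)^w, f]` is KZ-equivalent to a normal form `n = [(0,1)^w, C + A·∏ 2/(1+xᵢ²)]` with
`C, A` real algebraic. (Stated inline; no definition is introduced.) -/

/-- Reducedness only depends on the values of the function on the open box. [folklore] -/
theorem red_congr {f g : (Fin w → ℝ) → ℝ}
    (h : ∃ (C A : ℝ) (s n : KZ.IntegralRep w), IsAlgebraic ℚ C ∧ IsAlgebraic ℚ A ∧
      s.domain = KZ.unitCube w ∧ n.domain = KZ.unitCube w ∧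
      (∀ x ∈ KZ.unitCube w, s.integrand x = f x) ∧
      (∀ x ∈ KZ.unitCube w, n.integrand x = C + A * ∏ i, 2 / (1 + (x i) ^ 2)) ∧
      KZ.Equivalent s n)
    (hfg : ∀ x ∈ KZ.unitCube w, f x = g x) :
    ∃ (C A : ℝ) (s n : KZ.IntegralRep w), IsAlgebraic ℚ C ∧ IsAlgebraic ℚ A ∧
      s.domain = KZ.unitCube w ∧ n.domain = KZ.unitCube w ∧
      (∀ x ∈ KZ.unitCube w, s.integrand x = g x) ∧
      (∀ x ∈ KZ.unitCube w, n.integrand x = C + A * ∏ i, 2 / (1 + (x i) ^ 2)) ∧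
      KZ.Equivalent s n := by
  obtain ⟨C, A, s, n, hC, hA, hsd, hnd, hsi, hni, hsn⟩ := h
  exact ⟨C, A, s, n, hC, hA, hsd, hnd, fun x hx => (hsi x hx).trans (hfg x hx), hni, hsn⟩

/-- **Additivity.** Reduced functions are closed under addition: two integrand-additivity moves
(rule 1b) and addition of the normal forms. [cite: KontsevichZagier2001, §1.2 rule (1)] -/
theorem red_add {f g : (Fin w → ℝ) → ℝ}
    (hf : ∃ (C A : ℝ) (s n : KZ.IntegralRep w), IsAlgebraic ℚ C ∧ IsAlgebraic ℚ A ∧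
      s.domain = KZ.unitCube w ∧ n.domain = KZ.unitCube w ∧
      (∀ x ∈ KZ.unitCube w, s.integrand x = f x) ∧
      (∀ x ∈ KZ.unitCube w, n.integrand x = C + A * ∏ i, 2 / (1 + (x i) ^ 2)) ∧
      KZ.Equivalent s n)
    (hg : ∃ (C A : ℝ) (s n : KZ.IntegralRep w), IsAlgebraic ℚ C ∧ IsAlgebraic ℚ A ∧
      s.domain = KZ.unitCube w ∧ n.domain = KZ.unitCube w ∧
      (∀ x ∈ KZ.unitCube w, s.integrand x = g x) ∧
      (∀ x ∈ KZ.unitCube w, n.integrand x = C + A * ∏ i, 2 / (1 + (x i) ^ 2)) ∧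
      KZ.Equivalent s n) :
    ∃ (C A : ℝ) (s n : KZ.IntegralRep w), IsAlgebraic ℚ C ∧ IsAlgebraic ℚ A ∧
      s.domain = KZ.unitCube w ∧ n.domain = KZ.unitCube w ∧
      (∀ x ∈ KZ.unitCube w, s.integrand x = f x + g x) ∧
      (∀ x ∈ KZ.unitCube w, n.integrand x = C + A * ∏ i, 2 / (1 + (x i) ^ 2)) ∧
      KZ.Equivalent s n := by
  obtain ⟨C, A, s, n, hC, hA, hsd, hnd, hsi, hni, hsn⟩ := hf
  obtain ⟨C', A', s', n', hC', hA', hsd', hnd', hsi', hni', hsn'⟩ := hg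
  obtain ⟨S, hSd, hSi, hS⟩ := exists_addRep s s' (hsd'.trans hsd.symm)
  obtain ⟨M, hMd, hMi, hM⟩ := exists_addRep n n' (hnd'.trans hnd.symm)
  refine ⟨C + C', A + A', S, M, hC.add hC', hA.add hA', hSd.trans hsd, hMd.trans hnd,
    fun x hx => ?_, fun x hx => ?_, ?_⟩
  · rw [hSi, ← hsi x hx, ← hsi' x hx]
  · rw [hMi]
    show n.integrand x + n'.integrand x = _
    rw [hni x hx, hni' x hx]
    ring
  · have h := sub_mem (add_mem (add_mem hS hsn) hsn') hM
    show KZ.of S - KZ.of M ∈ KZ.relations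
    convert h using 1
    abel

/-- **Scaling.** Reduced functions are closed under multiplication by real algebraic constants
(`KZ.IntegralRep.constMul`, `KZ.Equivalent.constMul`: the scaling endomorphism preserves the
relations). [cite: KontsevichZagier2001, §1.2] -/
theorem red_smul {f : (Fin w → ℝ) → ℝ}
    (hf : ∃ (C A : ℝ) (s n : KZ.IntegralRep w), IsAlgebraic ℚ C ∧ IsAlgebraic ℚ A ∧
      s.domain = KZ.unitCube w ∧ n.domain = KZ.unitCube w ∧
      (∀ x ∈ KZ.unitCube w, s.integrand x = f x) ∧
      (∀ x ∈ KZ.unitCube w, n.integrand x = C + A * ∏ i, 2 / (1 + (x i) ^ 2)) ∧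
      KZ.Equivalent s n)
    {a : ℝ} (ha : IsAlgebraic ℚ a) :
    ∃ (C A : ℝ) (s n : KZ.IntegralRep w), IsAlgebraic ℚ C ∧ IsAlgebraic ℚ A ∧
      s.domain = KZ.unitCube w ∧ n.domain = KZ.unitCube w ∧
      (∀ x ∈ KZ.unitCube w, s.integrand x = a * f x) ∧
      (∀ x ∈ KZ.unitCube w, n.integrand x = C + A * ∏ i, 2 / (1 + (x i) ^ 2)) ∧
      KZ.Equivalent s n := by
  obtain ⟨C, A, s, n, hC, hA, hsd, hnd, hsi, hni, hsn⟩ := hf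
  refine ⟨a * C, a * A, s.constMul a ha, n.constMul a ha, ha.mul hC, ha.mul hA, hsd, hnd,
    fun x hx => ?_, fun x hx => ?_, KZ.Equivalent.constMul a ha hsn⟩
  · simp only [KZ.IntegralRep.integrand_constMul, hsi x hx]
  · simp only [KZ.IntegralRep.integrand_constMul, hni x hx]
    ring

/-- **Constants.** A real algebraic constant is reduced (it is its own normal form, `A = 0`).
[cite: KontsevichZagier2001, §1.1] -/
theorem red_const (w : ℕ) {c : ℝ} (hc : IsAlgebraic ℚ c) :
    ∃ (C A : ℝ) (s n : KZ.IntegralRep w), IsAlgebraic ℚ C ∧ IsAlgebraic ℚ A ∧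
      s.domain = KZ.unitCube w ∧ n.domain = KZ.unitCube w ∧
      (∀ x ∈ KZ.unitCube w, s.integrand x = c) ∧
      (∀ x ∈ KZ.unitCube w, n.integrand x = C + A * ∏ i, 2 / (1 + (x i) ^ 2)) ∧
      KZ.Equivalent s n := by
  obtain ⟨K, hKd, hKi⟩ := exists_boxRep
    (isSemialgebraicFunOn_const_of_isAlgebraic (KZ.isSemialgebraic_unitCube w) hc)
    (BoxIntegral.integrableOn_box_const w c)
  exact ⟨c, 0, K, K, hc, isAlgebraic_zero, hKd, hKd, fun x _ => by rw [hKi],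
    fun x _ => by rw [hKi]; ring, KZ.Equivalent.refl K⟩

/-- **Finite sums.** Reduced functions are closed under finite sums. [cite: KontsevichZagier2001, §1.2 rule (1)] -/
theorem red_sum {ι : Type*} (S : Finset ι) {f : ι → (Fin w → ℝ) → ℝ}
    (h : ∀ i ∈ S, ∃ (C A : ℝ) (s n : KZ.IntegralRep w), IsAlgebraic ℚ C ∧ IsAlgebraic ℚ A ∧
        s.domain = KZ.unitCube w ∧ n.domain = KZ.unitCube w ∧
        (∀ x ∈ KZ.unitCube w, s.integrand x = f i x) ∧
        (∀ x ∈ KZ.unitCube w, n.integrand x = C + A * ∏ i, 2 / (1 + (x i) ^ 2)) ∧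
        KZ.Equivalent s n) :
    ∃ (C A : ℝ) (s n : KZ.IntegralRep w), IsAlgebraic ℚ C ∧ IsAlgebraic ℚ A ∧
      s.domain = KZ.unitCube w ∧ n.domain = KZ.unitCube w ∧
      (∀ x ∈ KZ.unitCube w, s.integrand x = ∑ i ∈ S, f i x) ∧
      (∀ x ∈ KZ.unitCube w, n.integrand x = C + A * ∏ i, 2 / (1 + (x i) ^ 2)) ∧
      KZ.Equivalent s n := by
  classical
  induction S using Finset.induction_on with
  | empty => exact red_congr (red_const w isAlgebraic_zero) fun x _ => by simp
  | insert a S ha ih =>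
    exact red_congr (red_add (h a (Finset.mem_insert_self a S))
      (ih fun i hi => h i (Finset.mem_insert_of_mem hi))) fun x _ => by
        rw [Finset.sum_insert ha]

/-! ## Rational multiples of `𝔭_w` are reduced -/

/-- A representation on the open box which is KZ-equivalent to every `[(0,1)^w, q·∏ 2/(1+xᵢ²)]`
(`q ∈ ℚ`) has a reduced integrand (`C = 0`, `A = q`; the target representation exists:
`exists_omegaRep` scaled by `q`). [cite: KontsevichZagier2001, §1.2] -/
theorem red_of_ratMultiple {f : (Fin w → ℝ) → ℝ} (s : KZ.IntegralRep w)
    (hsd : s.domain = KZ.unitCube w) (hsi : ∀ x ∈ KZ.unitCube w, s.integrand x = f x)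
    (h : ∃ q : ℚ, ∀ (s' : KZ.IntegralRep w), s'.domain = {x | ∀ i, x i ∈ Set.Ioo (0:ℝ) 1} →
      Set.EqOn s'.integrand (fun x => (q : ℝ) * ∏ i, 2 / (1 + (x i) ^ 2)) s'.domain →
      KZ.Equivalent s s') :
    ∃ (C A : ℝ) (s n : KZ.IntegralRep w), IsAlgebraic ℚ C ∧ IsAlgebraic ℚ A ∧
      s.domain = KZ.unitCube w ∧ n.domain = KZ.unitCube w ∧
      (∀ x ∈ KZ.unitCube w, s.integrand x = f x) ∧
      (∀ x ∈ KZ.unitCube w, n.integrand x = C + A * ∏ i, 2 / (1 + (x i) ^ 2)) ∧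
      KZ.Equivalent s n := by
  obtain ⟨q, hq⟩ := h
  obtain ⟨P, hPd, hPi⟩ := exists_omegaRep w
  refine ⟨0, q, s, P.constMul (q : ℝ) (isAlgebraic_rat ℚ q), isAlgebraic_zero, isAlgebraic_rat ℚ q,
    hsd, hPd, hsi, fun x _ => ?_, hq _ hPd fun x _ => ?_⟩
  · rw [KZ.IntegralRep.integrand_constMul, hPi, zero_add]
  · rw [KZ.IntegralRep.integrand_constMul, hPi]

end Summit.KontsevichZagierPeriods.Theorems.HurwitzMicroSectorsHurwitzSectorComplement.Assembly

namespace Summit.KontsevichZagierPeriods.Theorems.HurwitzMicroSectorsHurwitzSectorComplement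

/-- **Registered sub-goal `assemblyKit_nfCoeffs` of `stub_assembly`**: rigidity of the normal-form values
`C + A(π/2)^w` for real algebraic `C, A` (`Assembly.nf_coeffs_eq`, Lindemann). [folklore] -/
theorem assemblyKit_nfCoeffs : ∀ (C A C' A' : ℝ) (w w' : ℕ), IsAlgebraic ℚ C → IsAlgebraic ℚ A → IsAlgebraic ℚ C' → IsAlgebraic ℚ A' → w ≠ 0 → w' ≠ 0 → C + A * (Real.pi / 2) ^ w = C' + A' * (Real.pi / 2) ^ w' → C = C' ∧ (w = w' → A = A') ∧ (w ≠ w' → A = 0 ∧ A' = 0) :=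
  fun _ _ _ _ _ _ hC hA hC' hA' hw hw' h => Assembly.nf_coeffs_eq hC hA hC' hA' hw hw' h

end Summit.KontsevichZagierPeriods.Theorems.HurwitzMicroSectorsHurwitzSectorComplement


end
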